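import Summits.HodgeConjecture.HodgeConjecture.Theses.PadicSemiregularLift
import Summits.HodgeConjecture.HodgeConjecture.Theses.AnchorTransport
import Summits.HodgeConjecture.HodgeConjecture.Theorems.HodgeAbelianVarieties.Negative.ExtremeCodimensions
import Literature.AlgebraicGeometry.Motives.CrystallineRealization
import Literature.AlgebraicGeometry.Motives.SupersingularAbelianVariety
import Literature.AlgebraicGeometry.Motives.FamiliesVHS
import Literature.AlgebraicGeometry.HodgeTheory.HodgeLocus
import Literature.AlgebraicGeometry.HodgeTheory.GlobalInvariantCycles
import Literature.AlgebraicGeometry.HodgeTheory.HodgeModelExistence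

/-!
# Skeleton line `inner-form-invariant-seeds` for crux `HodgeAbelianVarieties` (stmt-HodgeConjecture-1333) — gen 3 (+ lead -1 tightness glue)

Route `PadicSemiregularLift`, crux r4 (typed OUTPUT item)
`HodgeAbelianVarieties := ∀ A : AbelianVariety ℂ, HodgeConjectureFor A.dim A.X` — the Hodge conjecture
for every complex abelian variety (= the summit restricted to abelian varieties,
`Negative.iff_hodgeConjecture_restricted`, landed p70486, IMPORTED here).

## Provenance of this version (line lead prover-line-stmt-HodgeConjecture-1333-0, 2026-08-16)

* gen 1 (planner …-inner-form-invariant-0, 01:41Z): four stubs `stub_hodgeGenericAnchors`,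
  `stub_classicalPackage`, `stub_innerFormSpan`, `stub_rationalPVHC`.
* lead wave 1 (three stub workers, 01:50–02:20Z; audits attached to the crux item as evidence
  `stub_hodgeGenericAnchors.lean`, `stub_classicalPackage.lean`, `stub_innerFormSpan.lean`, all rc 0 / 0 sorry):
  (W1) geography TRUE IN PRINT, 0 Shimura/integral-model/basic-locus declarations in Mathlib or the tree,
  dim-0 instance PROVED in full (incl. `Nonempty (K(p,𝔽̄_p) →+* ℂ)` by Steinitz); (W2) classical package TRUE
  at every `PadicModel`, pure construction debt (no value of `WeilCohomology`/`CrystallineRealization`/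
  `DeRhamRealization` over any field; the zero theory dies on `bijective_trace`, kernel-checked), and gen-1's
  `hodgeAreTate` clause INERT (`ℂ`-span statement implied by `periodSpan`+`bijective_bo`+Lenstra–Zarhin);
  (W3) `∀ genuine anchors, SpansHodge` is NOT derivable from genuineness and is wider than print (Kisin's
  inner form needs hyperspecial level / basic points / Hodge-genericity, data an `Anchor` cannot carry);
  exact residual `R = HodgeSpanDescends ∧ InnerFormIdentity`, `spansHodge_of_residual` PROVED.
* gen 2 (planner …-inner-form-invariant-g2-0, 02:17Z, concurrent with wave 1, same diagnosis reached
  independently): ∃-packaged stub 1 `stub_innerFormAnchors` (GEO ∧ PKG ∧ B1 per abelian variety), inert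
  `hodgeAreTate` dropped, and the open stub made the route's SEED statement `stub_starSeeds` (typed P2a at
  abelian anchors with (⋆)), consuming the route's typed cruxes P1a `FormalLiftingFromClassLifting`
  (stmt-13825) and P3a `FormalVectorBundlesAlgebraize` (stmt-14106) BY NAME — triage r1-1's recommendation.
* gen 3 (this file, lead): the gen-2 ARCHITECTURE rebuilt by the lead on the wave-1-audited vocabulary
  (the gen-2 `.lean` was superseded in `Lines/` by the lead's interim 2-stub reshape of gen 1 at 02:22Z before
  the lead had seen gen 2; its card `Lines/inner-form-invariant-seeds.md` is gen 2's and describes exactly the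
  statements below). Registered stubs: `stub_innerFormAnchors : InnerFormAnchors`, `stub_starSeeds : StarSeeds`.
  Everything else — the engine `StarSeeds ⟹ FormalSeeds ⟹ (rational pVHC in the middle degrees)`, the anchor
  glue, the extreme degrees, the composition, and the two engine-agnostic FALLBACK compositions
  (`HodgeAbelianVarieties_of_formalSeeds`, `HodgeAbelianVarieties_of_rationalPVHC`) — is PROVED here.
* lead re-seat prover-line-stmt-HodgeConjecture-1333-1 (04:30Z, after lead -0's `promote-stub: stub_starSeeds` at 03:52Z and the
  04:04Z KILL of the route's seed crux P2a `SemiregularSeedsOnAnchors`, stmt-13941, at a Fermat sextic anchor): statements and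
  stubs UNCHANGED (same registration a45a6ad9 → re-registered); ADDED Glue IV below — kernel-checked TIGHTNESS at one anchor
  (`Anchor.rationalPVHCFor_iff_hodgeConjectureFor`: at a genuine, spanning, tight anchor with cycle descent the engine image of
  the open stub is literally `HodgeConjectureFor` for the anchored fibre) — as the formal half of the L5 verdict
  `Lines/inner-form-invariant-seeds.dead.md` (line dead at `stub_starSeeds`: no supplier after the P2a kill, HC-equivalent
  residue at the line's own anchors, no reshape inside the line below `RationalPVHCFor`).

## The line (crux idea `inner-form-invariant-seeds`, ideator 3; triage r1: fail / pass / pass)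

Put `A` at a point `t` of the smallest special subvariety `S` (`G` = generic Mumford–Tate group); at a
hyperspecial prime `p > dim A + 6` whose decomposition group contains complex conjugation the basic locus of
Kisin's integral model is supersingular and non-empty; at a basic point `x`, Kisin's group `I_x` (stabiliser
of ALL tensors `s_{α,0}`) is an inner form of `G` with `I_x ⊗ ℚ_p = J_b`, `J_b(ℚ_p)` Zariski dense in
`G(K₀)`, so on the Lefschetz algebra `U` of `A_x` (all crystalline Tate classes, rationally)
`U^{I_x} ⊗ ℚ_p = Hdg_gen ⊗ ℚ_p`: p-adically the Hodge classes of the generic member ARE `I_x`-invariant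
rational divisor polynomials on the special fibre, each Hodge at a Baire-generic lift `y` over the generic
point of `S_ℚ̄`. OUTPUT recorded as `Anchor.SpansHodge`, packaged EXISTENTIALLY with geography and the
classical package (STUB 1, known in print). LOAD-BEARING: STUB 2 `stub_starSeeds` — every `u ∈ U_Hdg(y)`,
`1 ≤ r < dim`, is up to `N ≠ 0` a `ch_r`-combination of finite locally free `E_i` on the special fibre with
the BEK Hodge condition in all degrees and (⋆) class-lifts-imply-object-lifts; the route's engine then runs BY
NAME inside the composition: BEK Thm 1.3 (tree predicate `BlochEsnaultKerzLifting C`) ⇒ pro-class lift;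
P1a ⇒ `LiftsFormally`; P3a ⇒ `LiftsTo`; `bo_chCris` ⇒ `bo u` algebraic on `Y_K`; period/cycle compatibility
⇒ algebraic on `A_y ⊗_ι ℂ`; SPANNING ⇒ cycle part of HC there; P2c ⇒ HC for `A`.

TYPING (triage r1-2 (2), r1-3 (2)): all p-adic content is relative to the hypothesis structure
`CrystallineRealization`, never closed under a bare `∀ C`. STUB 1 is `∃` over an `Anchor` (= `PadicModel` on
REAL carriers: `p`, `k = k̄`, smooth proper `𝒴/W(k)` of rel. dim `n`, `n + 6 < p`, special fibre `= A₀.X` for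
a SUPERSINGULAR `A₀ : AbelianVariety k`, `ι : K →+* ℂ`, `X ≅ Y_K ⊗_ι ℂ`; plus `C` and a period comparison
`cmp i : H_dR(Y_K) →ₛₗ[ι] complexBetti X i`) with `IsGenuine` = exactly the classical facts consumed
downstream (period span/injectivity, cycle-class and filtration compatibility, specialization of cycles,
U-pinning `DivisorClassesAreChern` + `RationallyLefschetz`, Lenstra–Zarhin, Berthelot–Ogus 3.8,
Bloch–Esnault–Kerz 1.3, and P1a's standing hypotheses on the model VERBATIM: projective over `W`,
`H^b(𝒪)`/`H^b(Ω¹)` `p`-torsion-free, `Ω¹` free or `n ≤ 3`). STUB 2 is `∀` over `(p, k = k̄, C, model)`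
with the same facts as HYPOTHESES; its conclusion `StarSeedsFor` is about REAL objects ((⋆) is `C`-free —
`IsFiniteLocallyFree`, `KZero`, thickenings) plus `C`'s own `ch`/`bo`/`fil`. No inhabitant of
`IsSmoothProperModel` of positive dimension exists in the tree, so no Lean re-decoration refutation is
available against either stub; STUB 1 cannot be junk-inhabited (no value of `WeilCohomology` is constructible:
W2 audit).

## Disproof used (cdisprove `Disproof.lean` cycles 1–3, NO KILL of the crux)
`iff_hodgeConjecture_restricted` (consistency `example`: the skeleton proves exactly HC|AV);
`hodgeAbelianVarieties_iff_deepMiddle` / `mem_algebraicClasses_of_dim_le` (USED: STUB 2 is asked only for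
`1 ≤ r < dim`; the extreme degrees are proved here for any smooth projective `X`,
`mem_algebraicClasses_of_extreme`, and are exactly where the BEK Hodge condition is vacuous);
`not_allHodgeTypeClassesAlgebraic…` (rational classes quantified; `U` pinned rational; the `ℚ_p`-analogue never
asserted); `not_integralSaturation…` (everything up to `N ≠ 0` / `K`-, `ℂ`-spans); `_false_without_proper` /
`_false_without_groupLaw` (properness + group law used at STUB 1 (moduli, abelian scheme `A_y`) and STUB 2
(`A₀ : AbelianVariety k`)); `kaehler_analogue_fails` (N/A: `W`-models are algebraic); §8
`not_hodgeRingDivisorGenerated…` (honoured: special-fibre divisors are never asked to lift, only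
`I_x`-invariant divisor POLYNOMIALS, realised by `ch` of (⋆)-bundles); §3 `weilItems_of` (first open instance
of STUB 2 = rational Weil-plane generator on `E⁶ ⊗ 𝔽̄_p`, `p` inert, Weil sixfolds of disc `≠ -1`); cycle 3
Findings 14–16 (a seed for a Weil generator on `E^{2n}`, `n ≥ 3`, is not `{0,1}`-semiregular after lifting:
(⋆) must be certified with `σ_{n-1}` — recorded, STUB 2 asks for (⋆) itself, not for a semiregularity
certificate); P1a's disprover near-miss `not_cruxWithoutStar` ((⋆) load-bearing — STUB 2 supplies it).
No `_false_without_<H>` about p-adic data exists; `ledger negatives` (ELineConnectivity, DerivedTorelliFermat):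
no contact; no stub is an instance of a landed Negative lemma.
-/

set_option linter.dupNamespace false

noncomputable section

open CategoryTheory AlgebraicGeometry
open scoped Isocrystal
open Literature.AlgebraicGeometry Literature.AlgebraicGeometry.Motives
  Literature.AlgebraicGeometry.HodgeTheory Literature.AlgebraicGeometry.Crystalline
  Literature.AlgebraicGeometry.KTheory

namespace Summit.HodgeConjecture.HodgeConjecture.Cruxes.HodgeAbelianVarieties.InnerFormInvariantSeeds

/-! ### Vocabulary, p-adic side (real carriers: `WittScheme`, `AbelianVariety`, `IsSupersingular`) -/

/-- A **supersingular p-adic model** of a complex `n`-fold `X` (REAL carriers only, no cohomology): a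
prime `p` with `n + 6 < p` (the route's anchor bound, Bloch–Esnault–Kerz), an algebraically closed field
`k` of characteristic `p` (intended `𝔽̄_p`), a smooth proper model `𝒴 / W(k)` of relative dimension `n`
whose special fibre is (the underlying scheme of) a SUPERSINGULAR abelian variety `A₀ / k`
(`AbelianVariety.IsSupersingular`: `A₀ ⊗ k̄ ~ E^n`), and a ring embedding `ι : K = W(k)[1/p] → ℂ` along
which the generic fibre becomes `X`: `X ≅ Y_K ⊗_{K,ι} ℂ`. (Wave 1: `special_eq` is never the obstruction —
`GrpObj.ofIso` moves a group law onto the special fibre; `Nonempty (K(p,𝔽̄_p) →+* ℂ)` is proved; the dim-0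
instance is constructed in full.) -/
structure PadicModel (n : ℕ) (X : SchemeOver ℂ) where
  /-- the residue characteristic -/
  p : ℕ
  [prime : Fact p.Prime]
  /-- the route's anchor bound `n < p - 6` -/
  large : n + 6 < p
  /-- the residue field (intended `𝔽̄_p`) -/
  k : Type
  [field : Field k]
  [charP : CharP k p]
  [perfect : PerfectRing k p]
  [algClosed : IsAlgClosed k]
  /-- the model over `W(k)` -/
  𝒴 : SchemeOver (WittVector p k)
  model : WittScheme.IsSmoothProperModel n 𝒴
  /-- the special fibre as an abelian variety over `k` -/
  A₀ : AbelianVariety k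
  special_eq : A₀.X = WittScheme.specialFibre 𝒴
  supersingular : A₀.IsSupersingular
  /-- the complex embedding of `K = W(k)[1/p]` -/
  ι : K(p, k) →+* ℂ
  iso : Nonempty (X ≅ (baseChangeHom ι).obj (WittScheme.genericFibre 𝒴))

attribute [instance] PadicModel.prime PadicModel.field PadicModel.charP PadicModel.perfect
  PadicModel.algClosed

/-- An **anchor** of `X`: a supersingular p-adic model together with the p-adic cohomological package —
a crystalline realization `C` over `k` (the tree's hypothesis structure) and a period comparison
`cmp i : Hⁱ_dR(Y_K/K) →ₛₗ[ι] Hⁱ(X(ℂ); ℂ)`. INTERFACE ONLY: which values are meant is said by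
`Anchor.IsGenuine`; existence is asserted only EXISTENTIALLY, per abelian variety, by STUB 1. -/
structure Anchor (n : ℕ) (X : SchemeOver ℂ) extends PadicModel n X where
  /-- crystalline realization over `k` (intended: Berthelot's, with the Berthelot–Ogus comparison) -/
  C : CrystallineRealization p k
  /-- period comparison (intended: Grothendieck's algebraic de Rham theorem + GAGA + base change along
  `ι` + the iso `X ≅ Y_K ⊗_ι ℂ`) -/
  cmp : ∀ i : ℕ, C.dR.obj (WittScheme.genericFibre 𝒴) i →ₛₗ[ι] complexBetti X i

namespace Anchor

variable {n : ℕ} {X : SchemeOver ℂ} (D : Anchor n X)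

/-- `U_Hdg(y)` in degree `2r`: the RATIONAL algebraic classes `u` of the special fibre whose
Berthelot–Ogus image lies in `Fʳ H²ʳ_dR(Y_K/K)` — "rational special-fibre classes that are Hodge at the
lift". For the anchors of STUB 1 this contains (and by B1 is `K`-spanned together with) `U^{I_x}`. -/
def UHdg (r : ℕ) : Set (D.C.obj (WittScheme.specialFibre D.𝒴) (2 * r)) :=
  {u | u ∈ D.C.ratAlgebraicClasses (WittScheme.specialFibre D.𝒴) r ∧
    D.C.bo D.𝒴 (2 * r) u ∈ D.C.dR.fil (2 * r) r}

/-- The image of `U_Hdg(y)` in complex cohomology: `cmp ∘ bo (U_Hdg)`. -/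
def anchoredClasses (r : ℕ) : Set (complexBetti X (2 * r)) :=
  (fun u => D.cmp (2 * r) (D.C.bo D.𝒴 (2 * r) u)) '' D.UHdg r

/-- **SPANNING** — the OUTPUT of the inner-form lever at this anchor: every rational class of Hodge type
`(r,r)` on `X` lies in the `ℂ`-span of `cmp ∘ bo (U_Hdg)`. -/
def SpansHodge : Prop :=
  ∀ (r : ℕ) (c : complexBetti X (2 * r)), IsRationalClass c → IsOfHodgeType n X (2 * r) r r c →
    c ∈ Submodule.span ℂ (D.anchoredClasses r)

end Anchor

/-- The Betti Hodge filtration step `Fʳ H²ʳ(X(ℂ); ℂ)` rendered over the tree's `IsOfHodgeType`: the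
`ℂ`-span of the classes of pure type `(a, b)`, `a + b = 2r`, `a ≥ r`. -/
def bettiHodgeFil (n : ℕ) (X : SchemeOver ℂ) (r : ℕ) : Submodule ℂ (complexBetti X (2 * r)) :=
  Submodule.span ℂ {c | ∃ a b : ℕ, a + b = 2 * r ∧ r ≤ a ∧ IsOfHodgeType n X (2 * r) a b c}

section Crystalline

variable {p : ℕ} [Fact p.Prime] {k : Type} [Field k] [CharP k p] [PerfectRing k p]

/-- **Specialization of cycles** (property of the classical realization `C`; Fulton §20.3 +
Berthelot–Ogus 1983 §3 / Gillet–Messing 1987): on every smooth proper `𝒳/W(k)`, every rational algebraic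
class of the GENERIC fibre is the Berthelot–Ogus image of a rational algebraic class of the SPECIAL fibre. -/
def SpecializationOfCycles (C : CrystallineRealization p k) : Prop :=
  ∀ ⦃d : ℕ⦄ ⦃𝒳 : SchemeOver (WittVector p k)⦄, WittScheme.IsSmoothProperModel d 𝒳 →
    ∀ (r : ℕ) (x : C.dR.obj (WittScheme.genericFibre 𝒳) (2 * r)),
      x ∈ C.dR.ratAlgebraicClasses (WittScheme.genericFibre 𝒳) r →
      ∃ u ∈ C.ratAlgebraicClasses (WittScheme.specialFibre 𝒳) r, C.bo 𝒳 (2 * r) u = x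

/-- **Divisor classes are Chern classes of line bundles** on the `k`-scheme `X` (relative to `C`;
Gros 1985 / Gillet–Messing 1987: `cl(D) = c₁(𝒪(D))`). Lead's note F-b: this yields `ℤ`-COMBINATIONS of
`c₁(Lᵢ)`; `CrystallineRealization` has no `⊗`-additivity of `c₁`, so the `r = 1` rung is formal only in the
Pic-form "`N • u = c₁(L)` for ONE rank-one `L`" (cf. `bo_chCris_mem_span_of_lineBundle` below). -/
def DivisorClassesAreChern (C : CrystallineRealization p k) (X : SchemeOver k) : Prop :=
  ∀ x ∈ C.ratAlgebraicClasses X 1, ∃ N : ℤ, N ≠ 0 ∧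
    N • x ∈ AddSubgroup.closure {c | ∃ L : X.left.Modules, HasRank L 1 ∧ c = C.chCris X L 1}

/-- **Rationally Lefschetz** (relative to `C`; the `ℚ`-form of Tate + Deuring for a supersingular abelian
variety: every rational algebraic class of codimension `r` is up to `N ≠ 0` a `ℤ`-combination of `r`-th
powers of rational divisor classes; Milne 1999 §1, Lenstra–Zarhin 1993). -/
def RationallyLefschetz (C : CrystallineRealization p k) (X : SchemeOver k) : Prop :=
  ∀ (r : ℕ), ∀ x ∈ C.ratAlgebraicClasses X r, ∃ N : ℤ, N ≠ 0 ∧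
    N • x ∈ AddSubgroup.closure
      (Set.range fun D : C.ratAlgebraicClasses X 1 => C.pow X (D : C.obj X 2) r)

/-- **(⋆) CLASS-LIFTS-IMPLY-OBJECT-LIFTS** for a module `E₁` on the special fibre of `𝒳/W(k)` — the
hypothesis of the route's typed crux P1a `FormalLiftingFromClassLifting` (stmt-HodgeConjecture-13825),
VERBATIM (`C`-free, real carriers: thickenings `X_n = 𝒳 ⊗ W/pⁿ`, `IsFiniteLocallyFree`, Fulton's `K₀`):
for every `n` and every finite locally free `F` on `X_{n+1}` with `F|X_k ≅ E₁`, if `[F] ∈ K₀(X_{n+1})` is the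
restriction of a class in `K₀(X_{n+2})` then `F` is the restriction of a finite locally free `F'` on
`X_{n+2}`. On paper it follows from p-adic semiregularity (the route's informal P1b). -/
def ClassLiftsImplyObjectLifts (𝒳 : SchemeOver (WittVector p k))
    (E₁ : (WittScheme.specialFibre 𝒳).left.Modules) : Prop :=
  ∀ (n : ℕ) (F : (WittScheme.thickening 𝒳 (n + 1)).left.Modules) (hF : IsFiniteLocallyFree F),
    Nonempty ((Scheme.Modules.pullback (WittScheme.specialFibreToThickening 𝒳 n)).obj F ≅ E₁) →
    (∃ y : KZero (WittScheme.thickening 𝒳 (n + 2)).left,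
        KZero.map (WittScheme.thickeningMap 𝒳 (Nat.le_succ (n + 1))) y = KZero.of F hF) →
    ∃ F' : (WittScheme.thickening 𝒳 (n + 2)).left.Modules, IsFiniteLocallyFree F' ∧
      Nonempty ((Scheme.Modules.pullback (WittScheme.thickeningMap 𝒳 (Nat.le_succ (n + 1)))).obj F' ≅ F)

/-- **P1a's standing hypotheses on the model**, VERBATIM (so that the route's crux is consumed by name):
smooth proper of relative dimension `d`, projective over `W`, `d + 6 < p`, `H^b(𝒳,𝒪)` and `H^b(𝒳,Ω¹)`
without `p`-torsion for all `b`, and `d ≤ 3` or `Ω¹` free (on paper: every `H^b(Ω^a)` torsion-free; automatic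
for abelian schemes). -/
structure ModelHypotheses (d : ℕ) (𝒳 : SchemeOver (WittVector p k)) : Prop where
  /-- `𝒳/W` is a smooth proper model of relative dimension `d` -/
  smoothProper : WittScheme.IsSmoothProperModel d 𝒳
  /-- `𝒳` is projective over the ring `W(k)` (BEK Thm 1.3) -/
  projective : IsProjectiveOverRing 𝒳
  /-- the Bloch–Esnault–Kerz bound -/
  large : d + 6 < p
  /-- `H^b(𝒳, 𝒪)` has no `p`-torsion -/
  torsionFree_structureSheaf :
    ∀ (b : ℕ) (x : structureSheafCohomology 𝒳.left b), (p : ℤ) • x = 0 → x = 0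
  /-- `H^b(𝒳, Ω¹)` has no `p`-torsion -/
  torsionFree_hodgeOne : ∀ (b : ℕ) (x : hodgeCohomologyOne 𝒳 b), (p : ℤ) • x = 0 → x = 0
  /-- `d ≤ 3` or `Ω¹_{𝒳/W}` is free of rank `d` -/
  cotangent_free : d ≤ 3 ∨
    Nonempty (cotangentSheaf 𝒳 ≅ SheafOfModules.free (R := 𝒳.left.ringCatSheaf) (Fin d))

/-- The **(⋆)-seed classes** in degree `2r` on the special fibre of `𝒴` (relative to `C`): crystalline Chern
characters `ch_r(E)` of finite locally free `E` satisfying the BEK Hodge condition in ALL degrees and (⋆). -/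
def starSeedClasses (C : CrystallineRealization p k) (𝒴 : SchemeOver (WittVector p k)) (r : ℕ) :
    Set (C.obj (WittScheme.specialFibre 𝒴) (2 * r)) :=
  {x | ∃ (E : (WittScheme.specialFibre 𝒴).left.Modules) (_ : IsFiniteLocallyFree E),
      C.HodgeCondition 𝒴 E ∧ ClassLiftsImplyObjectLifts 𝒴 E ∧
        x = C.chCris (WittScheme.specialFibre 𝒴) E r}

/-- **(⋆)-SEEDS for the model `𝒴`** of relative dimension `d` (the conclusion of STUB 2 at one model): every
rational algebraic class `u` of the special fibre in a MIDDLE codimension `1 ≤ r < d` whose Berthelot–Ogus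
image lies in `Fʳ` is, up to `N ≠ 0`, a `ℤ`-combination of (⋆)-seed classes. -/
def StarSeedsFor (C : CrystallineRealization p k) (d : ℕ) (𝒴 : SchemeOver (WittVector p k)) : Prop :=
  ∀ (r : ℕ), 1 ≤ r → r < d → ∀ u ∈ C.ratAlgebraicClasses (WittScheme.specialFibre 𝒴) r,
    C.bo 𝒴 (2 * r) u ∈ C.dR.fil (2 * r) r →
    ∃ N : ℤ, N ≠ 0 ∧ N • u ∈ AddSubgroup.closure (starSeedClasses C 𝒴 r)

/-- The **formally liftable seed classes**: `ch_r(E)` of modules `E` on the special fibre that lift to the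
`p`-adic formal completion of `𝒴` (`WittScheme.LiftsFormally`). Engine-agnostic intermediate. -/
def formalSeedClasses (C : CrystallineRealization p k) (𝒴 : SchemeOver (WittVector p k)) (r : ℕ) :
    Set (C.obj (WittScheme.specialFibre 𝒴) (2 * r)) :=
  {x | ∃ E : (WittScheme.specialFibre 𝒴).left.Modules, WittScheme.LiftsFormally 𝒴 E ∧
      x = C.chCris (WittScheme.specialFibre 𝒴) E r}

/-- **FORMAL SEEDS for `𝒴`** (fallback C⁺ if (⋆)-seeds die but rational pVHC lives at object level): as
`StarSeedsFor` with (⋆)+Hodge condition replaced by formal liftability. -/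
def FormalSeedsFor (C : CrystallineRealization p k) (d : ℕ) (𝒴 : SchemeOver (WittVector p k)) : Prop :=
  ∀ (r : ℕ), 1 ≤ r → r < d → ∀ u ∈ C.ratAlgebraicClasses (WittScheme.specialFibre 𝒴) r,
    C.bo 𝒴 (2 * r) u ∈ C.dR.fil (2 * r) r →
    ∃ N : ℤ, N ≠ 0 ∧ N • u ∈ AddSubgroup.closure (formalSeedClasses C 𝒴 r)

/-- **Rational p-adic variational Hodge for `𝒴` in the middle degrees** (relative to `C`; the weakest,
engine-free fallback, = rational Fontaine–Messing / BEK Conj. 1.2 class-level statement, OPEN in print for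
`r ≥ 2`): `u` rational algebraic on the special fibre with `bo u ∈ Fʳ` ⟹ `bo u ∈ K · A^r(Y_K)`. -/
def RationalPVHCFor (C : CrystallineRealization p k) (d : ℕ) (𝒴 : SchemeOver (WittVector p k)) : Prop :=
  ∀ (r : ℕ), 1 ≤ r → r < d → ∀ u ∈ C.ratAlgebraicClasses (WittScheme.specialFibre 𝒴) r,
    C.bo 𝒴 (2 * r) u ∈ C.dR.fil (2 * r) r →
    C.bo 𝒴 (2 * r) u ∈ Submodule.span K(p, k)
      (C.dR.ratAlgebraicClasses (WittScheme.genericFibre 𝒴) r :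
        Set (C.dR.obj (WittScheme.genericFibre 𝒴) (2 * r)))

end Crystalline

namespace Anchor

variable {n : ℕ} {X : SchemeOver ℂ}

/-- **Genuineness** of an anchor: exactly the classical facts about (model, crystalline realization, de Rham
realization, Berthelot–Ogus map, period comparison) that the composition consumes — each a theorem in print
for the CLASSICAL package at the anchors of STUB 1 (wave-1 audit W2: in fact at every `PadicModel`), consumed
as hypotheses (named-fact pattern). Gen-1's inert clause `hodgeAreTate` is dropped (W2/W3). -/
structure IsGenuine (D : Anchor n X) : Prop where
  /-- period isomorphism, spanning half: `ℂ · cmp (H_dR(Y_K/K)) = H(X(ℂ); ℂ)` (Grothendieck 1966 + GAGA) -/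
  periodSpan : ∀ i : ℕ, Submodule.span ℂ (Set.range (D.cmp i)) = ⊤
  /-- … and `cmp` is injective. -/
  periodInjective : ∀ i : ℕ, Function.Injective (D.cmp i)
  /-- cycle classes: the period of an algebraic de Rham class lies in `algebraicClasses X r = Nʳ H²ʳ`. -/
  cycleCompatible : ∀ (r : ℕ) (x : D.C.dR.obj (WittScheme.genericFibre D.𝒴) (2 * r)),
    x ∈ D.C.dR.ratAlgebraicClasses (WittScheme.genericFibre D.𝒴) r →
      D.cmp (2 * r) x ∈ algebraicClasses X r
  /-- Hodge filtration: `cmp (Fʳ H²ʳ_dR) ⊆ Fʳ H²ʳ_B` … -/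
  filCompatible : ∀ (r : ℕ) (x : D.C.dR.obj (WittScheme.genericFibre D.𝒴) (2 * r)),
    x ∈ D.C.dR.fil (2 * r) r → D.cmp (2 * r) x ∈ bettiHodgeFil n X r
  /-- … and `Fʳ H²ʳ_B ⊆ ℂ · cmp (Fʳ H²ʳ_dR)`. -/
  filSpans : ∀ r : ℕ, bettiHodgeFil n X r ≤
    Submodule.span ℂ (D.cmp (2 * r) ''
      (D.C.dR.fil (X := WittScheme.genericFibre D.𝒴) (2 * r) r :
        Set (D.C.dR.obj (WittScheme.genericFibre D.𝒴) (2 * r))))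
  /-- specialization of cycles (Fulton §20.3 + Berthelot–Ogus / Gillet–Messing), for all models. -/
  specialization : SpecializationOfCycles D.C
  /-- divisor classes of the special fibre are `c₁` of line bundles (Gros / Gillet–Messing) … -/
  divisorClasses : DivisorClassesAreChern D.C (WittScheme.specialFibre D.𝒴)
  /-- … every rational algebraic class of the supersingular special fibre is a rational divisor polynomial … -/
  rationallyLefschetz : RationallyLefschetz D.C (WittScheme.specialFibre D.𝒴)
  /-- … and they `K`-span cohomology (the tree's Lenstra–Zarhin fact at `D.C`, `D.A₀`). -/
  lefschetz : LenstraZarhin1993_supersingular_lefschetzClasses_eq_top D.C.toWeilCohomology D.A₀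
  /-- Berthelot–Ogus 1983 Thm. 3.8 (the `r = 1` calibration input). -/
  lineBundles : D.C.BerthelotOgusLineBundleLifting
  /-- Bloch–Esnault–Kerz 2014 Thm. 1.3 (the tree's named-fact predicate on `C`). -/
  bek : BlochEsnaultKerzLifting D.C
  /-- P1a hypothesis: `𝒴` is projective over `W(k)` (an abelian scheme over a DVR is). -/
  projective : IsProjectiveOverRing D.𝒴
  /-- P1a hypothesis: `H^b(𝒴, 𝒪)` has no `p`-torsion (abelian scheme: `∧^b` of a free module). -/
  torsionFree_structureSheaf :
    ∀ (b : ℕ) (x : structureSheafCohomology D.𝒴.left b), (D.p : ℤ) • x = 0 → x = 0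
  /-- P1a hypothesis: `H^b(𝒴, Ω¹)` has no `p`-torsion. -/
  torsionFree_hodgeOne : ∀ (b : ℕ) (x : hodgeCohomologyOne D.𝒴 b), (D.p : ℤ) • x = 0 → x = 0
  /-- P1a hypothesis: `n ≤ 3` or `Ω¹_{𝒴/W}` is free (abelian scheme: invariant differentials). -/
  cotangent_free : n ≤ 3 ∨
    Nonempty (cotangentSheaf D.𝒴 ≅ SheafOfModules.free (R := D.𝒴.left.ringCatSheaf) (Fin n))

end Anchor

/-! ### Vocabulary, complex side (real carriers: families over `ℚ̄`, `fiberOver`, `complexBetti`) -/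

/-- `s ∈ S(ℂ)` is **`ℚ̄`-generic**: it lies on no proper Zariski-closed subset of `S = S₀ ⊗_σ ℂ` defined
over `ℚ̄` — the genericity hypothesis of the route item `HodgeLocusPropagation`, verbatim. -/
def IsQbarGeneric (σ : AlgebraicClosure ℚ →+* ℂ) (S₀ : SchemeOver (AlgebraicClosure ℚ))
    (s : ComplexPoints ((baseChangeHom σ).obj S₀)) : Prop :=
  ∀ Z : Set (ComplexPoints ((baseChangeHom σ).obj S₀)), IsDefinedOverQbar σ S₀ Z → s ∈ Z → Z = Set.univ

/-- **The Hodge classes of `A ≅ 𝒳_t` extend to global classes on the total space that are still rational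
Hodge classes on the fibre at `s`** (fixed-part theorem + trivial monodromy of Mumford–Tate invariants over
a neat-level special subvariety). -/
def ExtendsHodgeClasses (A : AbelianVariety ℂ) {𝒳 S : SchemeOver ℂ} (f : 𝒳 ⟶ S)
    (t s : ComplexPoints S) (eA : A.X ≅ fiberOver f t) : Prop :=
  ∀ (p : ℕ) (c : complexBetti A.X (2 * p)), IsRationalClass c → IsOfHodgeType A.dim A.X (2 * p) p p c →
    ∃ 𝔄 : complexBetti 𝒳 (2 * p),
      complexBetti.map eA.hom (2 * p) (complexBetti.map (fiberι f t) (2 * p) 𝔄) = c ∧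
      IsRationalClass (complexBetti.map (fiberι f s) (2 * p) 𝔄) ∧
      IsOfHodgeType A.dim (fiberOver f s) (2 * p) p p (complexBetti.map (fiberι f s) (2 * p) 𝔄)

/-! ### Vocabulary of the lever's residual (wave 1, worker 3: the typed content of card claim B1) -/

/-- The `ℂ`-span of the rational `(r,r)`-classes of `X` (the Hodge classes `Hdg^{2r}(X) ⊗ ℂ`). -/
def hodgeSpan (n : ℕ) (X : SchemeOver ℂ) (r : ℕ) : Submodule ℂ (complexBetti X (2 * r)) :=
  Submodule.span ℂ {c | IsRationalClass c ∧ IsOfHodgeType n X (2 * r) r r c}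

namespace Anchor

variable {n : ℕ} {X : SchemeOver ℂ} (D : Anchor n X)

/-- `H_K := cmp⁻¹ (Hdg ⊗ ℂ)`: the `K`-rational de Rham classes of `Y_K` whose period lies in the span of the
Hodge classes. -/
def hodgeDR (r : ℕ) : Submodule K(D.p, D.k) (D.C.dR.obj (WittScheme.genericFibre D.𝒴) (2 * r)) :=
  (hodgeSpan n X r).comap (D.cmp (2 * r))

/-- **Residual `R_desc`** (descent of the Hodge span to `K`; Deligne 1982 Thm. 2.11 + inertia acts
trivially by good reduction over `W(k)`; crystalline incarnation Blasius 1994 / Ogus 1982 §4). -/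
def HodgeSpanDescends : Prop :=
  ∀ (r : ℕ) (c : complexBetti X (2 * r)), IsRationalClass c → IsOfHodgeType n X (2 * r) r r c →
    c ∈ Submodule.span ℂ (D.cmp (2 * r) ''
      (D.hodgeDR r : Set (D.C.dR.obj (WittScheme.genericFibre D.𝒴) (2 * r))))

/-- **Residual `R_inv`** (Kisin's inner-form identity `H_K ≤ K · bo (U_Hdg)`: `U^{I_x} ⊗ ℚ_p = Hdg ⊗ ℚ_p`
at basic points of hyperspecial integral canonical models, Kisin 2017 §2; Steinberg + Borel 18.3;
invariants commute with base change; `U^{I_x} ⊆ U_Hdg`). In print ONLY at such anchors. -/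
def InnerFormIdentity : Prop :=
  ∀ r : ℕ, D.hodgeDR r ≤ Submodule.span K(D.p, D.k) (D.C.bo D.𝒴 (2 * r) '' D.UHdg r)

end Anchor

/-! ### Named statements of the two registered stubs (and the two fallback C⁺'s) -/

/-- Statement of `stub_innerFormAnchors` (see there). -/
def InnerFormAnchors : Prop :=
  ∀ A : AbelianVariety ℂ,
    ∃ (σ : AlgebraicClosure ℚ →+* ℂ) (𝒳₀ S₀ : SchemeOver (AlgebraicClosure ℚ)) (f₀ : 𝒳₀ ⟶ S₀)
      (t s : ComplexPoints ((baseChangeHom σ).obj S₀))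
      (eA : A.X ≅ fiberOver ((baseChangeHom σ).map f₀) t),
      IsQuasiProjectiveOver S₀ ∧ IrreducibleSpace S₀.left ∧
      IsSmoothProjectiveFamily ((baseChangeHom σ).map f₀) A.dim ∧
      IsQbarGeneric σ S₀ s ∧
      ExtendsHodgeClasses A ((baseChangeHom σ).map f₀) t s eA ∧
      ∃ D : Anchor A.dim (fiberOver ((baseChangeHom σ).map f₀) s), D.IsGenuine ∧ D.SpansHodge

/-- Statement of `stub_starSeeds` (see there): (⋆)-seeds at every supersingular abelian anchor, with the
classical facts about `C` and the P1a hypotheses on the model carried as HYPOTHESES. -/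
def StarSeeds : Prop :=
  ∀ (p : ℕ) [Fact p.Prime] (k : Type) [Field k] [CharP k p] [PerfectRing k p] [IsAlgClosed k]
    (C : CrystallineRealization p k),
    C.BerthelotOgusLineBundleLifting → BlochEsnaultKerzLifting C →
    ∀ ⦃d : ℕ⦄ ⦃𝒴 : SchemeOver (WittVector p k)⦄ (A₀ : AbelianVariety k),
      ModelHypotheses d 𝒴 → A₀.X = WittScheme.specialFibre 𝒴 → A₀.IsSupersingular →
      DivisorClassesAreChern C (WittScheme.specialFibre 𝒴) →
      RationallyLefschetz C (WittScheme.specialFibre 𝒴) →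
      LenstraZarhin1993_supersingular_lefschetzClasses_eq_top C.toWeilCohomology A₀ →
      StarSeedsFor C d 𝒴

/-- FALLBACK C⁺ no. 1 (unregistered): formal seeds at every supersingular abelian anchor. -/
def FormalSeeds : Prop :=
  ∀ (p : ℕ) [Fact p.Prime] (k : Type) [Field k] [CharP k p] [PerfectRing k p] [IsAlgClosed k]
    (C : CrystallineRealization p k),
    C.BerthelotOgusLineBundleLifting → BlochEsnaultKerzLifting C →
    ∀ ⦃d : ℕ⦄ ⦃𝒴 : SchemeOver (WittVector p k)⦄ (A₀ : AbelianVariety k),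
      ModelHypotheses d 𝒴 → A₀.X = WittScheme.specialFibre 𝒴 → A₀.IsSupersingular →
      DivisorClassesAreChern C (WittScheme.specialFibre 𝒴) →
      RationallyLefschetz C (WittScheme.specialFibre 𝒴) →
      LenstraZarhin1993_supersingular_lefschetzClasses_eq_top C.toWeilCohomology A₀ →
      FormalSeedsFor C d 𝒴

/-- FALLBACK C⁺ no. 2 (unregistered; gen-1's open stub, middle degrees): rational pVHC at every
supersingular abelian anchor. -/
def RationalPVHC : Prop :=
  ∀ (p : ℕ) [Fact p.Prime] (k : Type) [Field k] [CharP k p] [PerfectRing k p] [IsAlgClosed k]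
    (C : CrystallineRealization p k),
    C.BerthelotOgusLineBundleLifting → BlochEsnaultKerzLifting C →
    ∀ ⦃d : ℕ⦄ ⦃𝒴 : SchemeOver (WittVector p k)⦄ (A₀ : AbelianVariety k),
      ModelHypotheses d 𝒴 → A₀.X = WittScheme.specialFibre 𝒴 → A₀.IsSupersingular →
      DivisorClassesAreChern C (WittScheme.specialFibre 𝒴) →
      RationallyLefschetz C (WittScheme.specialFibre 𝒴) →
      LenstraZarhin1993_supersingular_lefschetzClasses_eq_top C.toWeilCohomology A₀ →
      RationalPVHCFor C d 𝒴

/-! ### The two registered stubs -/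

/-- STUB 1 (XL as infrastructure; TRUE IN PRINT up to assembly — GEOGRAPHY ∧ CLASSICAL PACKAGE ∧ LEVER, packaged
EXISTENTIALLY per abelian variety) — **inner-form anchors**: for every complex abelian variety `A` there are
`σ : ℚ̄ → ℂ`, a smooth projective family `f₀ : 𝒳₀ → S₀` over an irreducible quasi-projective `ℚ̄`-base, points
`t, s ∈ S(ℂ)` with `A ≅ 𝒳_t` and `s` `ℚ̄`-GENERIC, such that every rational `(p,p)`-class of `A` is the
restriction of a global class whose restriction to `𝒳_s` is again rational of type `(p,p)`, AND a GENUINE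
anchor `D` of `𝒳_s` (supersingular p-adic model + classical crystalline/de Rham/period package with P1a's
model hypotheses) which is SPANNING. PAPER PROOF: (GEO) neat-level Hodge-type Shimura variety through `A`
over the smallest special subvariety, global Hodge classes by the fixed-part theorem (Deligne 1971 4.1.1,
with `ℚ`-coefficients; Charles–Schnell 11.3.5), hyperspecial `p > dim A + 6` with complex conjugation in the
decomposition group, supersingular non-empty basic locus of Kisin's integral canonical model (Kisin 2017 §1,
Kisin–Madapusi Pera–Shin 2022; Viehmann–Wedhorn 2013), Baire-generic `W(𝔽̄_p)`-lift `y` of a basic point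
over the generic point of `S_ℚ̄`, `ι : W(𝔽̄_p)[1/p] ↪ ℂ` (`Nonempty (K(p,𝔽̄_p) →+* ℂ)` PROVED, W1),
`s := ι(y)`, `𝒴 := A_y` an abelian scheme (projective; `H^b(Ω^a)` free; `Ω¹` free); (PKG) Berthelot +
Grothendieck dR + Berthelot–Ogus + GAGA period comparison; BO 3.8, BEK 1.3, Fulton 20.3 + Gillet–Messing,
Tate + Deuring + Milne 1999 / Lenstra–Zarhin, Deligne 1982 §1 cycle compatibility — all theorems at every
such model (W2); (B1, the LEVER) at THIS anchor `R = HodgeSpanDescends ∧ InnerFormIdentity` (Deligne 1982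
absolute Hodge + inertia descent; Kisin 2010 §2.2–2.3 / 2017 (1.3.6) + Blasius 1994; Kisin 2017 §2 Cor.
2.3.1/2.3.5; Steinberg + Borel 18.3; Tate 1966 + Deuring; invariants commute with base change), whence
`SpansHodge` by the PROVED `Anchor.spansHodge_of_residual`. WHY IT MIGHT FAIL (as a formal item): only by
size — constructions C1 (a value of `WeilCohomology k K`), C2 (`CrystallineRealization p k`), C3
(`DeRhamRealization K(p,k)` + `bo`), C4 (`cmp` vs `complexBetti`), C5 (Hodge-type Shimura varieties, integral
canonical models, basic loci) are absent from Mathlib and the tree. Leans on (existing, unproved):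
route item stmt-HodgeConjecture-13944 (P2b, informal), stmt-HodgeConjecture-1943 (`HodgeModels`); tree facts
`deligne_globalInvariantCycles`, `charlesSchnell_hodgeClass_of_flat`, `nonempty_hodgeModel` (no `_holds`).
Dimension `0` is PROVED for the gen-1 statements (evidence: `hodgeGenericAnchors_of_dim_eq_zero`,
`spansHodge_of_dim_zero`). -/
theorem stub_innerFormAnchors : InnerFormAnchors := by
  sorry

/-- STUB 2 (XL, OPEN — the load-bearing stub, = the route's informal crux P2a `SemiregularSeedsOnAnchors`
(stmt-HodgeConjecture-13941) TYPED AT ABELIAN ANCHORS at object level, with "p-adically semiregular" replaced by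
its typed consequence (⋆) and "α ∈ K-span{bo ch(Eᵢ)} + Lef" sharpened to exact realisation of the canonical
targets `u`) — **(⋆)-seeds on supersingular abelian anchors**: for `k = k̄` of characteristic `p`, `C` with
Berthelot–Ogus 3.8 and Bloch–Esnault–Kerz 1.3, every model `𝒴/W(k)` satisfying P1a's hypotheses
(`ModelHypotheses d 𝒴`) whose special fibre is a supersingular abelian variety `A₀` with divisor-polynomial
rational classes (U-pinning) and Lenstra–Zarhin: every `u ∈ U_Hdg` in codimension `1 ≤ r < d` is, up to
`N ≠ 0`, a `ℤ`-combination `Σ aᵢ ch_r(Eᵢ)` of finite locally free `Eᵢ` on the special fibre with the BEK Hodge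
condition in ALL degrees and (⋆) (`StarSeedsFor`). The ENGINE `StarSeedsFor ⟹ FormalSeedsFor ⟹ rational pVHC
in the middle degrees` is PROVED below from P1a + BEK + P3a (`formalSeedsFor_of_starSeedsFor`,
`rationalPVHCFor_of_formalSeedsFor`). WHY PLAUSIBLE / ATTACKABLE: canonical finitely generated targets
(generators of `U^{I_x}`, a definite quaternion-hermitian invariant ring on `⋀^{2r}(B^g)`; census 1,…,1,3 for
the Weil datum); CALIBRATION `r = 1`: `u = c₁(L)/N` with `bo c₁(L) ∈ F¹` ⇒ `L` lifts formally (BO 3.8; proved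
as `bo_chCris_mem_span_of_lineBundle` modulo P3a) and (⋆) for line bundles is the determinant trick P1c;
LENGTH-ONE RUNG via `FormalSeeds` (`u = [B]`, `B ⊂ A_x` an abelian subvariety: Grothendieck–Messing +
Serre–Tate); FIRST OPEN INSTANCE = route kill criterion (b): a rational Weil-plane generator
`u ∈ (U³(E⁶ ⊗ 𝔽̄_p))^{I_x}`, `p` inert in `K`, along Weil sixfolds of disc `≠ -1` (Disproof §3). WHY IT MIGHT
FAIL: FORCED KERNELS — `dim Ext²(E,E)` grows with `E` against the fixed `Σ_q h^{q,q+2}(A₀)` (= 28 on an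
abelian fourfold) and every bundle realising a Weil generator may violate (⋆) (then RESHAPE to the proved
fallback composition `HodgeAbelianVarieties_of_formalSeeds`); a RATIONAL fake Hodge class would kill even
`FormalSeeds` and `RationalPVHC` (none known; Ogus's are `ℚ_p`-rational); Disproof cycle 3 Findings 14/16: a
seed for a Weil generator on `E^{2n}`, `n ≥ 3`, is not `{0,1}`-semiregular after lifting, so its (⋆) must be
certified with `σ_{n-1}`. Leans on: BlochEsnaultKerz2014pAdic Thm 1.3 / Conj 1.2, BerthelotOgus1983,
Pridham2024 / BuchweitzFlenner2003 (via P1b, informal stmt-13815), Markman2025SecantWeil, route items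
stmt-13825 (P1a, typed, open), stmt-14106 (P3a, typed, known), stmt-13941 (P2a, informal). -/
theorem stub_starSeeds : StarSeeds := by
  sorry

/-! ### Name-keyed aliases of the two statements (the hypotheses of the composition) -/
namespace Registered

/-- Alias of `InnerFormAnchors` keyed by the registered stub name. -/
abbrev stub_innerFormAnchors : Prop := InnerFormAnchors
/-- Alias of `StarSeeds` keyed by the registered stub name. -/
abbrev stub_starSeeds : Prop := StarSeeds

end Registered

theorem innerFormAnchors_holds : InnerFormAnchors := stub_innerFormAnchors
theorem starSeeds_holds : StarSeeds := stub_starSeeds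

/-! ### Glue I (proved): semilinear spans, transports, extreme degrees -/

section SemilinearSpan

variable {R S M N : Type*} [Semiring R] [Semiring S] {τ : R →+* S} [AddCommMonoid M]
  [AddCommMonoid N] [Module R M] [Module S N]

/-- A `τ`-semilinear map sends the `R`-span of `s` into the `S`-span of `f '' s` (Mathlib's
`Submodule.apply_mem_span_image_of_mem_span` needs `RingHomSurjective τ`, which `ι : K → ℂ` is not). -/
theorem semilinear_apply_mem_span_image (f : M →ₛₗ[τ] N) {s : Set M} {x : M}
    (hx : x ∈ Submodule.span R s) : f x ∈ Submodule.span S (f '' s) := by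
  induction hx using Submodule.span_induction with
  | mem y hy => exact Submodule.subset_span ⟨y, hy, rfl⟩
  | zero => rw [map_zero]; exact Submodule.zero_mem _
  | add y z _ _ hy hz => rw [map_add]; exact Submodule.add_mem _ hy hz
  | smul a y _ hy => rw [LinearMap.map_smulₛₗ]; exact Submodule.smul_mem _ _ hy

end SemilinearSpan

-- adapted from Literature/AlgebraicGeometry/Motives/CurveNet.lean (`IsSmoothProjective.of_iso`), which is
-- outside this line's import cone
/-- Smooth projective varieties are stable under isomorphism of `k`-schemes. -/
theorem isSmoothProjective_of_iso {k : Type} [Field k] {n : ℕ} {Y Z : SchemeOver k} (e : Y ≅ Z)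
    (h : IsSmoothProjective n Y) : IsSmoothProjective n Z where
  smoothOfRelativeDimension := by
    rw [show Z.hom = e.inv.left ≫ Y.hom from (Over.w e.inv).symm]
    exact (MorphismProperty.cancel_left_of_respectsIso (@SmoothOfRelativeDimension n) _ _).mpr
      h.smoothOfRelativeDimension
  isProjectiveOver := by
    obtain ⟨M, i, hi⟩ := h.isProjectiveOver
    refine ⟨M, e.inv ≫ i, ?_⟩
    rw [Over.comp_left]
    infer_instance
  geometricallyIrreducible := by
    rw [show Z.hom = e.inv.left ≫ Y.hom from (Over.w e.inv).symm]
    exact (MorphismProperty.cancel_left_of_respectsIso (@GeometricallyIrreducible) _ _).mpr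
      h.geometricallyIrreducible

/-- **Every complex `n`-fold with a p-adic model is smooth projective of dimension `n`** (generic fibre is;
base change along `ι`: `IsSmoothProjective.baseChangeHom_holds`; transport along `D.iso`). Wave 1, W3. -/
theorem PadicModel.isSmoothProjective {n : ℕ} {X : SchemeOver ℂ} (M : PadicModel n X) :
    IsSmoothProjective n X :=
  isSmoothProjective_of_iso M.iso.some.symm
    (IsSmoothProjective.baseChangeHom_holds M.ι M.model.isSmoothProjective_genericFibre)

/-- **Extreme codimensions are free** on any smooth projective complex `n`-fold: every class of degree `2r`
with `r = 0` or `n ≤ r` is algebraic (`p = 0`: `algebraicClasses_zero`; `r = n ≥ 1`: top degree; `r > n`: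
zero group). This is `Negative.mem_algebraicClasses_of_dim_le` (p70486) with the abelian binder replaced by
`IsSmoothProjective`, so that it applies to the anchored FIBRE `𝒳_s`. -/
theorem mem_algebraicClasses_of_extreme {n : ℕ} {X : SchemeOver ℂ} (hX : IsSmoothProjective n X)
    {r : ℕ} (hr : r = 0 ∨ n ≤ r) (c : complexBetti X (2 * r)) : c ∈ algebraicClasses X r := by
  rcases Nat.eq_zero_or_pos r with rfl | hr0
  · exact hodgeConjectureFor_codim_zero c
  have hnr : n ≤ r := hr.resolve_left (by omega)
  rcases hnr.eq_or_lt with rfl | hlt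
  · exact mem_algebraicClasses_of_degree_top hX hr0 c
  · haveI := ComplexPoints.subsingleton_singularCohomology_of_lt hX ℂ (k := 2 * r) (by omega)
    rw [Subsingleton.elim c 0]
    exact Submodule.zero_mem _

/-! ### Glue II (proved): THE ENGINE `(⋆)-seeds ⟹ formal seeds ⟹ rational pVHC (middle degrees)` -/

section Engine

variable {p : ℕ} [Fact p.Prime] {k : Type} [Field k] [CharP k p] [PerfectRing k p]

/-- **P1a + BEK give formal lifts of (⋆)-bundles with the Hodge condition**: the BEK Hodge condition on
`E₁` is condition (a) for `[E₁] ∈ K₀(X_k)_ℚ` (`hodgeConditionKZeroRat_of`), hence a rational pro-class lift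
(`exists_lift_of_hodgeConditionKZeroRat`, the tree's BEK predicate), hence by the route's P1a (consumed BY
NAME) a compatible system of lifts. -/
theorem liftsFormally_of_star
    (hP1a : Summit.HodgeConjecture.HodgeConjecture.Theses.PadicSemiregularLift.FormalLiftingFromClassLifting)
    (C : CrystallineRealization p k) (hBEK : BlochEsnaultKerzLifting C) {d : ℕ}
    {𝒴 : SchemeOver (WittVector p k)} (h : ModelHypotheses d 𝒴)
    (E₁ : (WittScheme.specialFibre 𝒴).left.Modules) (hE₁ : IsFiniteLocallyFree E₁)
    (hH : C.HodgeCondition 𝒴 E₁) (hstar : ClassLiftsImplyObjectLifts 𝒴 E₁) :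
    WittScheme.LiftsFormally 𝒴 E₁ :=
  hP1a p k d 𝒴 h.smoothProper h.projective h.large h.torsionFree_structureSheaf h.torsionFree_hodgeOne
    h.cotangent_free E₁ hE₁ hstar
    (exists_lift_of_hodgeConditionKZeroRat C hBEK h.smoothProper h.projective h.large
      ((C.hodgeConditionKZeroRat_of 𝒴 E₁ hE₁).2 hH))

/-- Hence (⋆)-seed classes are formal seed classes, and `StarSeedsFor ⟹ FormalSeedsFor` (P1a + BEK). -/
theorem formalSeedsFor_of_starSeedsFor
    (hP1a : Summit.HodgeConjecture.HodgeConjecture.Theses.PadicSemiregularLift.FormalLiftingFromClassLifting)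
    (C : CrystallineRealization p k) (hBEK : BlochEsnaultKerzLifting C) {d : ℕ}
    {𝒴 : SchemeOver (WittVector p k)} (h : ModelHypotheses d 𝒴) (hS : StarSeedsFor C d 𝒴) :
    FormalSeedsFor C d 𝒴 := by
  intro r h1 hrd u hu hfil
  obtain ⟨N, hN, hNu⟩ := hS r h1 hrd u hu hfil
  refine ⟨N, hN, AddSubgroup.closure_mono ?_ hNu⟩
  rintro _ ⟨E, hE, hH, hstar, rfl⟩
  exact ⟨E, liftsFormally_of_star hP1a C hBEK h E hE hH hstar, rfl⟩

/-- **Classes of algebraically liftable modules are algebraic on the generic fibre** (the KNOWN direction of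
p-adic variational Hodge at object level: `bo_chCris` + `chDR_mem_ratAlgebraicClasses` + `chCris_congr`). -/
theorem bo_chCris_mem_span_of_liftsTo (C : CrystallineRealization p k) {d : ℕ}
    {𝒴 : SchemeOver (WittVector p k)} (h𝒴 : WittScheme.IsSmoothProperModel d 𝒴)
    {E₁ : (WittScheme.specialFibre 𝒴).left.Modules} (hL : WittScheme.LiftsTo 𝒴 E₁) (r : ℕ) :
    C.bo 𝒴 (2 * r) (C.chCris (WittScheme.specialFibre 𝒴) E₁ r) ∈ Submodule.span K(p, k)
      (C.dR.ratAlgebraicClasses (WittScheme.genericFibre 𝒴) r :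
        Set (C.dR.obj (WittScheme.genericFibre 𝒴) (2 * r))) := by
  obtain ⟨E, hE, ⟨e⟩⟩ := hL
  rw [← C.chCris_congr e r, C.bo_chCris h𝒴 E hE r]
  exact Submodule.subset_span (C.chDR_mem_ratAlgebraicClasses h𝒴.isSmoothProjective_genericFibre _ r)

/-- `r = 1` CALIBRATION at object level (Berthelot–Ogus 3.8 + P3a): a rank-one `L` on the special fibre
whose `c₁` is Hodge at the lift has `bo c₁(L)` algebraic on the generic fibre, on any smooth proper model with
`H²(𝒴,𝒪)[p] = 0`, `p ≠ 2`. (Lead's finding F-b: the `r = 1` rung of `U_Hdg` follows from this only in the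
Pic-form of `DivisorClassesAreChern`.) -/
theorem bo_chCris_mem_span_of_lineBundle
    (hP3a : Summit.HodgeConjecture.HodgeConjecture.Theses.PadicSemiregularLift.FormalVectorBundlesAlgebraize)
    (C : CrystallineRealization p k) (hBO : C.BerthelotOgusLineBundleLifting) {d : ℕ}
    {𝒴 : SchemeOver (WittVector p k)} (h𝒴 : WittScheme.IsSmoothProperModel d 𝒴) (hp : p ≠ 2)
    (hH2 : ∀ x : structureSheafCohomology 𝒴.left 2, (p : ℤ) • x = 0 → x = 0)
    (L : (WittScheme.specialFibre 𝒴).left.Modules) (hL : HasRank L 1)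
    (hfil : C.bo 𝒴 (2 * 1) (C.chCris (WittScheme.specialFibre 𝒴) L 1) ∈ C.dR.fil (2 * 1) 1) (r : ℕ) :
    C.bo 𝒴 (2 * r) (C.chCris (WittScheme.specialFibre 𝒴) L r) ∈ Submodule.span K(p, k)
      (C.dR.ratAlgebraicClasses (WittScheme.genericFibre 𝒴) r :
        Set (C.dR.obj (WittScheme.genericFibre 𝒴) (2 * r))) :=
  bo_chCris_mem_span_of_liftsTo C h𝒴 (hP3a p k d 𝒴 h𝒴 L ((hBO h𝒴 hp hH2 L hL).2 hfil)) r

/-- **`ℚ`-saturation**: the classes whose Berthelot–Ogus image lies in the `K`-span of the algebraic classes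
of the generic fibre form a `ℚ`-saturated subgroup, so it suffices to control generators of a subgroup
containing a non-zero multiple of `u`. -/
theorem bo_mem_span_of_zsmul_mem_closure (C : CrystallineRealization p k)
    (𝒴 : SchemeOver (WittVector p k)) (r : ℕ) {S : Set (C.obj (WittScheme.specialFibre 𝒴) (2 * r))}
    (hS : ∀ x ∈ S, C.bo 𝒴 (2 * r) x ∈ Submodule.span K(p, k)
      (C.dR.ratAlgebraicClasses (WittScheme.genericFibre 𝒴) r :
        Set (C.dR.obj (WittScheme.genericFibre 𝒴) (2 * r))))
    {u : C.obj (WittScheme.specialFibre 𝒴) (2 * r)} {N : ℤ} (hN : N ≠ 0)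
    (hu : N • u ∈ AddSubgroup.closure S) :
    C.bo 𝒴 (2 * r) u ∈ Submodule.span K(p, k)
      (C.dR.ratAlgebraicClasses (WittScheme.genericFibre 𝒴) r :
        Set (C.dR.obj (WittScheme.genericFibre 𝒴) (2 * r))) := by
  set V := (Submodule.span K(p, k)
      (C.dR.ratAlgebraicClasses (WittScheme.genericFibre 𝒴) r :
        Set (C.dR.obj (WittScheme.genericFibre 𝒴) (2 * r)))).comap (C.bo 𝒴 (2 * r)) with hV
  have hle : AddSubgroup.closure S ≤ V.toAddSubgroup :=
    (AddSubgroup.closure_le _).2 fun x hx => hS x hx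
  have hNu : N • u ∈ V := hle hu
  have hNK : ((N : ℤ) : K(p, k)) ≠ 0 := Int.cast_ne_zero.2 hN
  have hu' : u = ((N : K(p, k))⁻¹) • ((N : K(p, k)) • u) := by
    rw [smul_smul, inv_mul_cancel₀ hNK, one_smul]
  have key : u ∈ V := by
    rw [hu']
    refine V.smul_mem _ ?_
    rw [Int.cast_smul_eq_zsmul]
    exact hNu
  exact key

/-- **Formal seeds give rational pVHC in the middle degrees** (P3a: formal lifts algebraize on a smooth proper
model; then `bo_chCris_mem_span_of_liftsTo` and `ℚ`-saturation). -/
theorem rationalPVHCFor_of_formalSeedsFor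
    (hP3a : Summit.HodgeConjecture.HodgeConjecture.Theses.PadicSemiregularLift.FormalVectorBundlesAlgebraize)
    (C : CrystallineRealization p k) {d : ℕ} {𝒴 : SchemeOver (WittVector p k)}
    (h𝒴 : WittScheme.IsSmoothProperModel d 𝒴) (hF : FormalSeedsFor C d 𝒴) : RationalPVHCFor C d 𝒴 := by
  intro r h1 hrd u hu hfil
  obtain ⟨N, hN, hNu⟩ := hF r h1 hrd u hu hfil
  refine bo_mem_span_of_zsmul_mem_closure C 𝒴 r ?_ hN hNu
  rintro _ ⟨E, hE, rfl⟩
  exact bo_chCris_mem_span_of_liftsTo C h𝒴 (hP3a p k d 𝒴 h𝒴 E hE) r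

/-- THE ENGINE in one line: (⋆)-seeds + P1a + BEK + P3a ⟹ rational pVHC in the middle degrees. -/
theorem rationalPVHCFor_of_starSeedsFor
    (hP1a : Summit.HodgeConjecture.HodgeConjecture.Theses.PadicSemiregularLift.FormalLiftingFromClassLifting)
    (hP3a : Summit.HodgeConjecture.HodgeConjecture.Theses.PadicSemiregularLift.FormalVectorBundlesAlgebraize)
    (C : CrystallineRealization p k) (hBEK : BlochEsnaultKerzLifting C) {d : ℕ}
    {𝒴 : SchemeOver (WittVector p k)} (h : ModelHypotheses d 𝒴) (hS : StarSeedsFor C d 𝒴) :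
    RationalPVHCFor C d 𝒴 :=
  rationalPVHCFor_of_formalSeedsFor hP3a C h.smoothProper (formalSeedsFor_of_starSeedsFor hP1a C hBEK h hS)

/-- The three C⁺'s are nested: `StarSeeds ⟹ FormalSeeds` (P1a) … -/
theorem formalSeeds_of_starSeeds
    (hP1a : Summit.HodgeConjecture.HodgeConjecture.Theses.PadicSemiregularLift.FormalLiftingFromClassLifting)
    (h : StarSeeds) : FormalSeeds :=
  fun p _ k _ _ _ _ C hBO hBEK _ _ A₀ hM hsp hss hdiv hlef hLZ =>
    formalSeedsFor_of_starSeedsFor hP1a C hBEK hM (h p k C hBO hBEK A₀ hM hsp hss hdiv hlef hLZ)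

/-- … and `FormalSeeds ⟹ RationalPVHC` (P3a). -/
theorem rationalPVHC_of_formalSeeds
    (hP3a : Summit.HodgeConjecture.HodgeConjecture.Theses.PadicSemiregularLift.FormalVectorBundlesAlgebraize)
    (h : FormalSeeds) : RationalPVHC :=
  fun p _ k _ _ _ _ C hBO hBEK _ _ A₀ hM hsp hss hdiv hlef hLZ =>
    rationalPVHCFor_of_formalSeedsFor hP3a C hM.smoothProper (h p k C hBO hBEK A₀ hM hsp hss hdiv hlef hLZ)

end Engine

/-! ### Glue III (proved): at one anchor -/

namespace Anchor

variable {n : ℕ} {X : SchemeOver ℂ} (D : Anchor n X)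

/-- A genuine anchor satisfies P1a's model hypotheses in relative dimension `n`. -/
theorem modelHypotheses (hD : D.IsGenuine) : ModelHypotheses n D.𝒴 :=
  ⟨D.model, hD.projective, D.large, hD.torsionFree_structureSheaf, hD.torsionFree_hodgeOne,
    hD.cotangent_free⟩

/-- Rational pVHC in the middle degrees at a genuine anchor, from any of the three C⁺'s. -/
theorem rationalPVHCFor_of_rationalPVHC (h : RationalPVHC) (hD : D.IsGenuine) :
    RationalPVHCFor D.C n D.𝒴 :=
  h D.p D.k D.C hD.lineBundles hD.bek D.A₀ (D.modelHypotheses hD) D.special_eq D.supersingular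
    hD.divisorClasses hD.rationallyLefschetz hD.lefschetz

/-- At an anchor with compatible cycle classes, rational pVHC in degree `r` makes every class of
`cmp ∘ bo (U_Hdg r)` algebraic on `X`. -/
theorem anchoredClasses_subset_algebraicClasses (hcc : ∀ (r : ℕ)
      (x : D.C.dR.obj (WittScheme.genericFibre D.𝒴) (2 * r)),
      x ∈ D.C.dR.ratAlgebraicClasses (WittScheme.genericFibre D.𝒴) r →
        D.cmp (2 * r) x ∈ algebraicClasses X r) {r : ℕ}
    (hR : ∀ u ∈ D.UHdg r, D.C.bo D.𝒴 (2 * r) u ∈ Submodule.span K(D.p, D.k)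
      (D.C.dR.ratAlgebraicClasses (WittScheme.genericFibre D.𝒴) r :
        Set (D.C.dR.obj (WittScheme.genericFibre D.𝒴) (2 * r)))) :
    D.anchoredClasses r ⊆ algebraicClasses X r := by
  rintro _ ⟨u, hu, rfl⟩
  have hle : Submodule.span K(D.p, D.k)
      (D.C.dR.ratAlgebraicClasses (WittScheme.genericFibre D.𝒴) r :
        Set (D.C.dR.obj (WittScheme.genericFibre D.𝒴) (2 * r))) ≤
      (algebraicClasses X r).comap (D.cmp (2 * r)) :=
    Submodule.span_le.2 fun x hx => hcc r x hx
  exact hle (hR u hu)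

/-- **Transfer at one anchor** (proved): genuineness + SPANNING + rational pVHC in the middle degrees give the
cycle part of the Hodge conjecture for `X` in EVERY codimension (the extreme ones are free,
`mem_algebraicClasses_of_extreme` via `PadicModel.isSmoothProjective`). -/
theorem cyclePart (hD : D.IsGenuine) (hS : D.SpansHodge) (hR : RationalPVHCFor D.C n D.𝒴)
    (r : ℕ) (c : complexBetti X (2 * r)) (hc : IsRationalClass c)
    (hH : IsOfHodgeType n X (2 * r) r r c) : c ∈ algebraicClasses X r := by
  by_cases hext : r = 0 ∨ n ≤ r
  · exact mem_algebraicClasses_of_extreme D.isSmoothProjective hext c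
  · simp only [not_or, not_le] at hext
    exact Submodule.span_le.2 (D.anchoredClasses_subset_algebraicClasses hD.cycleCompatible
      (fun u hu => hR r (Nat.pos_of_ne_zero hext.1) hext.2 u hu.1 hu.2)) (hS r c hc hH)

/-- **Formal reduction of the lever** (wave 1, W3): `R_desc ∧ R_inv ⊢ SpansHodge` — pure semilinear
algebra. The exact shape of what Kisin's inner form supplies on paper at the anchors of STUB 1. -/
theorem spansHodge_of_residual (h₁ : D.HodgeSpanDescends) (h₂ : D.InnerFormIdentity) :
    D.SpansHodge := by
  intro r c hc hH
  refine Submodule.span_le.2 ?_ (h₁ r c hc hH)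
  rintro _ ⟨x, hx, rfl⟩
  have h := semilinear_apply_mem_span_image (D.cmp (2 * r)) (h₂ r hx)
  rw [Set.image_image] at h
  exact h

end Anchor

/-! ### The composition: the two stubs + the route's P1a, P3a, P2c (+ IsoInvariance, HodgeModels) imply the crux -/

/-- **The crux from rational pVHC at the anchors of STUB 1** (the engine-agnostic core of the composition):
STUB 1 puts `A` at a point `t` of a `ℚ̄`-family with global Hodge classes and a `ℚ̄`-generic point `s` whose
fibre carries a genuine spanning supersingular anchor; `Anchor.cyclePart` gives the cycle part of HC on that
fibre; P2c `HodgeLocusPropagation` carries algebraicity of the global class from `s` to `t`;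
`AnchorTransport.IsoInvariance` moves it across `A.X ≅ 𝒳_t`; `AnchorTransport.HodgeModels`
(= `nonempty_hodgeModel`) discharges the anti-vacuity conjunct. -/
theorem HodgeAbelianVarieties_of_rationalPVHC (h₁ : InnerFormAnchors) (hR : RationalPVHC)
    (hP : Summit.HodgeConjecture.HodgeConjecture.Theses.PadicSemiregularLift.HodgeLocusPropagation)
    (hI : Summit.HodgeConjecture.HodgeConjecture.Theses.AnchorTransport.IsoInvariance)
    (hM : Summit.HodgeConjecture.HodgeConjecture.Theses.AnchorTransport.HodgeModels) :
    Summit.HodgeConjecture.HodgeConjecture.Theses.PadicSemiregularLift.HodgeAbelianVarieties := by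
  intro A
  refine (hodgeConjectureFor_iff_of_isSmoothProjective (hM A.dim A.X)
    (AbelianVariety.isSmoothProjective_holds (A := A))).2 ?_
  intro p c hc hH
  obtain ⟨σ, 𝒳₀, S₀, f₀, t, s, eA, hqp, hirr, hfam, hgen, hext, D, hD, hS⟩ := h₁ A
  obtain ⟨𝔄, h𝔄c, h𝔄rat, h𝔄hodge⟩ := hext p c hc hH
  -- HC (cycle part) on the anchored fibre `𝒳_s`: spanning + rational pVHC + genuineness
  have hs : complexBetti.map (fiberι ((baseChangeHom σ).map f₀) s) (2 * p) 𝔄 ∈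
      algebraicClasses (fiberOver ((baseChangeHom σ).map f₀) s) p :=
    D.cyclePart hD hS (D.rationalPVHCFor_of_rationalPVHC hR hD) p _ h𝔄rat h𝔄hodge
  -- propagate from the `ℚ̄`-generic point `s` to `t` (P2c), then across `A.X ≅ 𝒳_t`
  have ht := hP σ f₀ A.dim p hqp hirr hfam 𝔄 s hgen hs t
  have hA := hI eA p _ ht
  rwa [h𝔄c] at hA

/-- FALLBACK composition no. 1 (proved): `InnerFormAnchors → FormalSeeds → P3a → P2c → … → crux`. -/
theorem HodgeAbelianVarieties_of_formalSeeds (h₁ : InnerFormAnchors) (hF : FormalSeeds)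
    (hP3a : Summit.HodgeConjecture.HodgeConjecture.Theses.PadicSemiregularLift.FormalVectorBundlesAlgebraize)
    (hP : Summit.HodgeConjecture.HodgeConjecture.Theses.PadicSemiregularLift.HodgeLocusPropagation)
    (hI : Summit.HodgeConjecture.HodgeConjecture.Theses.AnchorTransport.IsoInvariance)
    (hM : Summit.HodgeConjecture.HodgeConjecture.Theses.AnchorTransport.HodgeModels) :
    Summit.HodgeConjecture.HodgeConjecture.Theses.PadicSemiregularLift.HodgeAbelianVarieties :=
  HodgeAbelianVarieties_of_rationalPVHC h₁ (rationalPVHC_of_formalSeeds hP3a hF) hP hI hM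

/-- **THE COMPOSITION**: `HodgeAbelianVarieties` from the two registered stubs and the route's typed items
P1a (stmt-13825), P3a (stmt-14106), P2c (stmt-13954), `AnchorTransport.IsoInvariance` (stmt-1078),
`AnchorTransport.HodgeModels` (stmt-1943), all consumed BY NAME (pure logic over the proved glue). -/
theorem HodgeAbelianVarieties_of (h₁ : Registered.stub_innerFormAnchors) (h₂ : Registered.stub_starSeeds)
    (hP1a : Summit.HodgeConjecture.HodgeConjecture.Theses.PadicSemiregularLift.FormalLiftingFromClassLifting)
    (hP3a : Summit.HodgeConjecture.HodgeConjecture.Theses.PadicSemiregularLift.FormalVectorBundlesAlgebraize)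
    (hP : Summit.HodgeConjecture.HodgeConjecture.Theses.PadicSemiregularLift.HodgeLocusPropagation)
    (hI : Summit.HodgeConjecture.HodgeConjecture.Theses.AnchorTransport.IsoInvariance)
    (hM : Summit.HodgeConjecture.HodgeConjecture.Theses.AnchorTransport.HodgeModels) :
    Summit.HodgeConjecture.HodgeConjecture.Theses.PadicSemiregularLift.HodgeAbelianVarieties :=
  HodgeAbelianVarieties_of_rationalPVHC h₁
    (rationalPVHC_of_formalSeeds hP3a (formalSeeds_of_starSeeds hP1a h₂)) hP hI hM

/-- Wiring check: the registered stubs feed `HodgeAbelianVarieties_of` as stated. -/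
example
    (hP1a : Summit.HodgeConjecture.HodgeConjecture.Theses.PadicSemiregularLift.FormalLiftingFromClassLifting)
    (hP3a : Summit.HodgeConjecture.HodgeConjecture.Theses.PadicSemiregularLift.FormalVectorBundlesAlgebraize)
    (hP : Summit.HodgeConjecture.HodgeConjecture.Theses.PadicSemiregularLift.HodgeLocusPropagation)
    (hI : Summit.HodgeConjecture.HodgeConjecture.Theses.AnchorTransport.IsoInvariance)
    (hM : Summit.HodgeConjecture.HodgeConjecture.Theses.AnchorTransport.HodgeModels) :
    Summit.HodgeConjecture.HodgeConjecture.Theses.PadicSemiregularLift.HodgeAbelianVarieties :=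
  HodgeAbelianVarieties_of stub_innerFormAnchors stub_starSeeds hP1a hP3a hP hI hM

/-- Consistency with the landed Negative lemma (p70486): what the skeleton proves is literally the summit
restricted to abelian varieties. -/
example (h₁ : InnerFormAnchors) (h₂ : StarSeeds)
    (hP1a : Summit.HodgeConjecture.HodgeConjecture.Theses.PadicSemiregularLift.FormalLiftingFromClassLifting)
    (hP3a : Summit.HodgeConjecture.HodgeConjecture.Theses.PadicSemiregularLift.FormalVectorBundlesAlgebraize)
    (hP : Summit.HodgeConjecture.HodgeConjecture.Theses.PadicSemiregularLift.HodgeLocusPropagation)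
    (hI : Summit.HodgeConjecture.HodgeConjecture.Theses.AnchorTransport.IsoInvariance)
    (hM : Summit.HodgeConjecture.HodgeConjecture.Theses.AnchorTransport.HodgeModels) :
    ∀ A : AbelianVariety ℂ, IsSmoothProjective A.dim A.X → HodgeConjectureFor A.dim A.X :=
  Summit.HodgeConjecture.HodgeConjecture.Theorems.HodgeAbelianVarieties.Negative.iff_hodgeConjecture_restricted.1
    (HodgeAbelianVarieties_of h₁ h₂ hP1a hP3a hP hI hM)

/-- Sanity (proved, the known direction at the object level, for modules that extend to `𝒴` itself). -/
theorem bo_chCris_mem_span {p : ℕ} [Fact p.Prime] {k : Type} [Field k] [CharP k p] [PerfectRing k p]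
    (C : CrystallineRealization p k) {d : ℕ} {𝒴 : SchemeOver (WittVector p k)}
    (h𝒴 : WittScheme.IsSmoothProperModel d 𝒴) (E : 𝒴.left.Modules) (hE : IsVectorBundle E) (r : ℕ) :
    C.bo 𝒴 (2 * r) (C.chCris (WittScheme.specialFibre 𝒴) (WittScheme.restrictSpecial 𝒴 E) r) ∈
      Submodule.span K(p, k)
        (C.dR.ratAlgebraicClasses (WittScheme.genericFibre 𝒴) r :
          Set (C.dR.obj (WittScheme.genericFibre 𝒴) (2 * r))) := by
  rw [C.bo_chCris h𝒴 E hE r]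
  exact Submodule.subset_span (C.chDR_mem_ratAlgebraicClasses h𝒴.isSmoothProjective_genericFibre _ r)


/-! ### Glue IV (lead re-seat -1, 2026-08-16): TIGHTNESS at one anchor — the engine image of the open stub IS the crux instance

The composition consumes the open stub `stub_starSeeds` only through its engine image `RationalPVHCFor D.C n D.𝒴` at the
genuine spanning anchor `D` of STUB 1 (`Anchor.cyclePart`). Conversely, granted the two classical DESCENT facts the deep
refuter isolated (drefute gen 1 `stub_innerFormSpan.md`, gen 2 §3/§5) — `UHdgAreHodge` (= card claim B2, "double
genericity": the periods of the `U_Hdg(y)` classes lie in `Hdg ⊗ ℂ`; the TIGHT form of the line) and `CycleDescent`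
(Hilbert-scheme spreading + Galois descent of cycle classes from `ℂ` to `K`, Deligne–Milne–Ogus–Shih I §1) — the cycle part
of HC for the anchored fibre in the middle degrees gives `RationalPVHCFor` back (`rationalPVHCFor_of_middleCyclePart`, three
lines). Hence at the line's own anchors the weakest open content the composition needs is LITERALLY `HodgeConjectureFor n X`
for the anchored fibre (`rationalPVHCFor_iff_hodgeConjectureFor`) — the kernel-checked form of triage r1-1's verdict
("transfer C⁺ is crux-equivalent") and of drefute g2's structure theorem §3(iv) (there proved on CM-adjacent lifts with B2 and
descent THEOREMS, certificate j011554). Recorded for the L5 note `Lines/inner-form-invariant-seeds.dead.md`. -/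

namespace Anchor

variable {n : ℕ} {X : SchemeOver ℂ} (D : Anchor n X)

/-- **B2 / the tight form** (card claim B2, Baire double genericity at the anchors of STUB 1): the period of every
`U_Hdg` class lies in the `ℂ`-span of the rational `(r,r)`-classes of `X`. -/
def UHdgAreHodge : Prop :=
  ∀ (r : ℕ), ∀ u ∈ D.UHdg r, D.cmp (2 * r) (D.C.bo D.𝒴 (2 * r) u) ∈ hodgeSpan n X r

/-- **Cycle descent** (DMOS I §1 + Hilbert schemes: algebraic classes on `X = Y_K ⊗_ι ℂ` are `ℂ`-spanned by classes of
cycles over `K̄`, and Galois-orbit sums descend to `K`): a `K`-rational de Rham class whose period is algebraic on `X` is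
a `K`-combination of `K`-rational algebraic de Rham classes of `Y_K`. -/
def CycleDescent : Prop :=
  ∀ (r : ℕ) (x : D.C.dR.obj (WittScheme.genericFibre D.𝒴) (2 * r)),
    D.cmp (2 * r) x ∈ algebraicClasses X r →
      x ∈ Submodule.span K(D.p, D.k)
        (D.C.dR.ratAlgebraicClasses (WittScheme.genericFibre D.𝒴) r :
          Set (D.C.dR.obj (WittScheme.genericFibre D.𝒴) (2 * r)))

end Anchor

/-- The cycle part of the Hodge conjecture for the complex `n`-fold `X` in the MIDDLE codimensions `1 ≤ r < n`
(the extreme ones are free, `mem_algebraicClasses_of_extreme`). -/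
def MiddleCyclePart (n : ℕ) (X : SchemeOver ℂ) : Prop :=
  ∀ (r : ℕ), 1 ≤ r → r < n → ∀ c : complexBetti X (2 * r), IsRationalClass c →
    IsOfHodgeType n X (2 * r) r r c → c ∈ algebraicClasses X r

namespace Anchor

variable {n : ℕ} {X : SchemeOver ℂ} (D : Anchor n X)

/-- **⟸ (new direction)**: the cycle part of HC for the anchored fibre in the middle degrees, B2 and cycle descent give
the engine image `RationalPVHCFor` at the anchor (pure linear algebra: `cmp (bo u) ∈ Hdg ⊗ ℂ ≤ algebraicClasses`, then
descend). No genuineness or spanning is needed for this direction. -/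
theorem rationalPVHCFor_of_middleCyclePart (hB2 : D.UHdgAreHodge) (hdesc : D.CycleDescent)
    (hHC : MiddleCyclePart n X) : RationalPVHCFor D.C n D.𝒴 := by
  intro r h1 hr u hu hfil
  refine hdesc r _ ?_
  have hle : hodgeSpan n X r ≤ algebraicClasses X r :=
    Submodule.span_le.2 fun c hc => hHC r h1 hr c hc.1 hc.2
  exact hle (hB2 r u ⟨hu, hfil⟩)

/-- **⟹ (the composition at one anchor, middle degrees)** = `Anchor.cyclePart`. -/
theorem middleCyclePart_of_rationalPVHCFor (hD : D.IsGenuine) (hS : D.SpansHodge)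
    (hR : RationalPVHCFor D.C n D.𝒴) : MiddleCyclePart n X :=
  fun r _ _ c hc hH => D.cyclePart hD hS hR r c hc hH

/-- **TIGHTNESS at a genuine, spanning, tight anchor with cycle descent**: the engine image of the open stub at the
anchor is EQUIVALENT to the cycle part of HC for the anchored fibre in the middle degrees. -/
theorem rationalPVHCFor_iff_middleCyclePart (hD : D.IsGenuine) (hS : D.SpansHodge) (hB2 : D.UHdgAreHodge)
    (hdesc : D.CycleDescent) : RationalPVHCFor D.C n D.𝒴 ↔ MiddleCyclePart n X :=
  ⟨D.middleCyclePart_of_rationalPVHCFor hD hS, D.rationalPVHCFor_of_middleCyclePart hB2 hdesc⟩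

/-- … and, with the Hodge-model fact (`nonempty_hodgeModel`, consumed as `AnchorTransport.HodgeModels` by the
composition), LITERALLY the tree's `HodgeConjectureFor n X` for the anchored fibre: at the line's own anchors the
line's weakest open content is the crux instance it is meant to prove. -/
theorem rationalPVHCFor_iff_hodgeConjectureFor (hM : nonempty_hodgeModel n X) (hD : D.IsGenuine)
    (hS : D.SpansHodge) (hB2 : D.UHdgAreHodge) (hdesc : D.CycleDescent) :
    RationalPVHCFor D.C n D.𝒴 ↔ HodgeConjectureFor n X := by
  rw [D.rationalPVHCFor_iff_middleCyclePart hD hS hB2 hdesc,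
    hodgeConjectureFor_iff_of_isSmoothProjective hM D.isSmoothProjective]
  constructor
  · intro h r c hc hH
    by_cases hext : r = 0 ∨ n ≤ r
    · exact mem_algebraicClasses_of_extreme D.isSmoothProjective hext c
    · simp only [not_or, not_le] at hext
      exact h r (Nat.pos_of_ne_zero hext.1) hext.2 c hc hH
  · intro h r _ _ c hc hH
    exact h r c hc hH

end Anchor

end Summit.HodgeConjecture.HodgeConjecture.Cruxes.HodgeAbelianVarieties.InnerFormInvariantSeeds

end
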